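import Summits.AtomisticToContinuum.BoseEinsteinCondensation.Theorems.BECGroundStateSOSPeriodicIRBoundDefs
import Summits.AtomisticToContinuum.BoseEinsteinCondensation.Theorems.BECGroundStateSOSPeriodicIRBoundWFDefs
import Summits.AtomisticToContinuum.BoseEinsteinCondensation.Theorems.BECGroundStateSOSPeriodicIRBoundWFPotCreate
import Summits.AtomisticToContinuum.BoseEinsteinCondensation.Theorems.BECGroundStateSOSPeriodicIRBoundWFPotCreate2
import Summits.AtomisticToContinuum.BoseEinsteinCondensation.Theorems.BECGroundStateSOSPeriodicIRBoundWFPotCross2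
import Literature.MathematicalPhysics.QuantumManyBody.PeriodicBoseGasMomentumSector
import Literature.MathematicalPhysics.QuantumManyBody.TorusFockLayer
import Literature.MathematicalPhysics.QuantumManyBody.TorusFockSectorInteraction
import Literature.MathematicalPhysics.QuantumManyBody.PeriodicFormDomain
import Literature.MathematicalPhysics.QuantumManyBody.PeriodicBoseGasTagged
import Mathlib.MeasureTheory.Integral.Bochner.ContinuousLinearMap
import HarnessLib

/-! # Crux `PeriodicIRBound` (stmt-AtomisticToContinuum-3972), line `linear-ph-floor-wagner`, stub 5b `stub_wagnerFeynman` — PotCreate3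
The potential of the particle state, part 3 (P-b) `P[a_k†Φ] = P[Φ] + (m+1)‖w‖₁/L³‖Φ‖² + P[a_kΦ] + 2(m+1)∑_b Re s_b + (m+1)Re E`, and the potential Wagner–Feynman inequality (P). -/

/-!

With `φ = planeWaveMode L k`, `h = sliceCoef L k Φ`, `W = periodicInteraction w L`, `B = exchFactor L k Φ` and
`O = ∫_{Λ^{m+2}} W.toReal · B` (`exchInt`):

* (4c) `W(Z) = w^per(Z₀-Z₁) + ∑_b w^per(Z₀-Z_{b+2}) + (∑_b w^per(Z₁-Z_{b+2}) + W(Z₂,…))` (`periodicInteraction_succ`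
  twice), additive under `toReal` where `W(Z) < ∞`, i.e. a.e.; with the four pieces of part 2 and
  `∫_{Λ^m} W.toReal |h|² = P[aΦ].toReal/(m+1)` (`integral_pot_norm_sliceCoef_sq`):
  `O = E + ∑_b s_b + (∑_b conj(s_b) + P[aΦ].toReal/(m+1))` (`exchInt_eq`), so
  `Re O = P[aΦ].toReal/(m+1) + 2 ∑_b Re s_b + Re E` (`re_exchInt_eq`, the brief's `re_O01_eq`);
* (3b) + (5) the direct term of part 1 is P-dir read in `ℝ`, and `potForm_modeCr` follows.
-/

noncomputable section

open scoped BigOperators ENNReal ComplexConjugate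
open Filter MeasureTheory

namespace Summit.AtomisticToContinuum.BoseEinsteinCondensation.Cruxes.PeriodicIRBound.LinearPhFloorWagner.WF

open Literature.MathematicalPhysics.QuantumManyBody.BoseGas

variable {M m n : ℕ} {L : ℝ}

-- `exchFactor` is a verbatim copy of the definition of part 2, to be deleted on merge)

/-! ## `∫ W.toReal |h|² = P[aΦ].toReal/(m+1)` (copies of the `WFPolar` toolkit) -/

/-- `(‖z‖₊²).toReal = ‖z‖²`. [folklore] -/
private theorem toReal_coe_nnnorm_sq_c3 (z : ℂ) : (((‖z‖₊ : ℝ≥0∞)) ^ 2).toReal = ‖z‖ ^ 2 := by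
  rw [coe_nnnorm_sq_eq_ofReal, ENNReal.toReal_ofReal (sq_nonneg _)]

/-- The potential density `W |g|²` is measurable. [folklore] -/
private theorem measurable_potDensity_c3 {w : ℝ → ℝ≥0∞} (hw : Measurable w) (L : ℝ) {g : Config M → ℂ}
    (hg : Continuous g) :
    Measurable fun X : Config M => periodicInteraction w L X * ((‖g X‖₊ : ℝ≥0∞)) ^ 2 :=
  (measurable_periodicInteraction_tk hw L).mul (hg.measurable.nnnorm.coe_nnreal_ennreal.pow_const _)

/-- `∫ W.toReal |g|² = P_w(g).toReal` when `P_w(g) < ∞`. [folklore] -/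
private theorem integral_potReal_c3 {w : ℝ → ℝ≥0∞} (hw : Measurable w) {g : Config M → ℂ} (hg : Continuous g)
    (hP : potForm w L g ≠ ⊤) :
    ∫ X in cellN M L, (periodicInteraction w L X).toReal * ‖g X‖ ^ 2 = (potForm w L g).toReal := by
  rw [potForm, ← integral_toReal (measurable_potDensity_c3 hw L hg).aemeasurable
    (ae_lt_top (measurable_potDensity_c3 hw L hg) hP)]
  refine integral_congr_ae (Eventually.of_forall fun X => ?_)
  simp only [ENNReal.toReal_mul, toReal_coe_nnnorm_sq_c3]

/-- `‖aΦ(Y)‖² = (m+1) ‖h(Y)‖²`. [folklore] -/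
theorem norm_modeAn_sq (L : ℝ) (k : Fin 3 → ℤ) (Φ : Config (m + 1) → ℂ) (Y : Config m) :
    ‖modeAn L (planeWaveMode L k) Φ Y‖ ^ 2 = (m + 1) * ‖sliceCoef L k Φ Y‖ ^ 2 := by
  rw [modeAn_apply, norm_mul, mul_pow, Complex.norm_real, Real.norm_of_nonneg (Real.sqrt_nonneg _),
    Real.sq_sqrt (by positivity)]
  rfl

/-- `∫_{Λ^m} W.toReal ‖h‖² = P[aΦ].toReal/(m+1)` (`aΦ = √(m+1) h` is continuous, `P[aΦ] < ∞` by P-d). [folklore] -/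
theorem integral_pot_norm_sliceCoef_sq (hL : 0 < L) {w : ℝ → ℝ≥0∞} (hw : Measurable w)
    (hint : (∫⁻ z : Space, w ‖z‖) ≠ ⊤) (k : Fin 3 → ℤ) {Φ : Config (m + 1) → ℂ} (hΦ : IsCore L Φ)
    (hP : potForm w L Φ ≠ ⊤) :
    ∫ Y in cellN m L, (periodicInteraction w L Y).toReal * ‖sliceCoef L k Φ Y‖ ^ 2 =
      (potForm w L (modeAn L (planeWaveMode L k) Φ)).toReal / (m + 1) := by
  have hfin := (potForm_modeAn_ne_top_and hL hw hint k hΦ hP).1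
  have hc := continuous_modeAn L (continuous_planeWaveMode L k) hΦ.contDiff.continuous
  rw [eq_div_iff (by positivity : (m + 1 : ℝ) ≠ 0), ← integral_potReal_c3 hw hc hfin, mul_comm,
    ← integral_const_mul]
  refine integral_congr_ae (Eventually.of_forall fun Y => ?_)
  dsimp only
  rw [norm_modeAn_sq]
  ring

/-! ## Step (4c): splitting the weight; the exchange integral -/

/-- Pointwise split of the pair interaction of `m+2` particles through particles `0` and `1`:
`W(Z) = w^per(Z₀-Z₁) + ∑_b w^per(Z₀-Z_{b+2}) + (∑_b w^per(Z₁-Z_{b+2}) + W(Z₂,…))` (`periodicInteraction_succ` twice).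
[folklore] -/
private theorem periodicInteraction_split_two (w : ℝ → ℝ≥0∞) (L : ℝ) (Z : Config (m + 2)) :
    periodicInteraction w L Z =
      periodizedPotential w L (Z 0 - Z 1) + ∑ b : Fin m, periodizedPotential w L (Z 0 - Z b.succ.succ) +
        ((∑ b : Fin m, periodizedPotential w L (Z 1 - Z b.succ.succ)) +
          periodicInteraction w L (Fin.tail (Fin.tail Z))) := by
  rw [periodicInteraction_succ w L Z, Fin.sum_univ_succ, periodicInteraction_succ w L (Matrix.vecTail Z)]
  rfl

/-- The same split for the real parts, where `W(Z) < ∞` (every piece is then finite). [folklore] -/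
private theorem toReal_periodicInteraction_split_two (w : ℝ → ℝ≥0∞) (L : ℝ) {Z : Config (m + 2)}
    (hZ : periodicInteraction w L Z ≠ ⊤) :
    (periodicInteraction w L Z).toReal =
      (periodizedPotential w L (Z 0 - Z 1)).toReal + ∑ b : Fin m, (periodizedPotential w L (Z 0 - Z b.succ.succ)).toReal +
        ((∑ b : Fin m, (periodizedPotential w L (Z 1 - Z b.succ.succ)).toReal) +
          (periodicInteraction w L (Fin.tail (Fin.tail Z))).toReal) := by
  have h01 : periodizedPotential w L (Z 0 - Z 1) ≠ ⊤ :=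
    ne_top_of_le_ne_top hZ (periodizedPotential_le_periodicInteraction w L Z Fin.zero_lt_one)
  have h0b : ∀ b : Fin m, periodizedPotential w L (Z 0 - Z b.succ.succ) ≠ ⊤ := fun b =>
    ne_top_of_le_ne_top hZ (periodizedPotential_le_periodicInteraction w L Z (Fin.succ_pos _))
  have h1b : ∀ b : Fin m, periodizedPotential w L (Z 1 - Z b.succ.succ) ≠ ⊤ := fun b =>
    ne_top_of_le_ne_top hZ (periodizedPotential_le_periodicInteraction w L Z (Fin.one_lt_succ_succ b))
  have htt : periodicInteraction w L (Fin.tail (Fin.tail Z)) ≠ ⊤ :=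
    ne_top_of_le_ne_top hZ ((periodicInteraction_tail_le w L _).trans (periodicInteraction_tail_le w L Z))
  have hs0 : ∑ b : Fin m, periodizedPotential w L (Z 0 - Z b.succ.succ) ≠ ⊤ := ENNReal.sum_ne_top.2 fun b _ => h0b b
  have hs1 : ∑ b : Fin m, periodizedPotential w L (Z 1 - Z b.succ.succ) ≠ ⊤ := ENNReal.sum_ne_top.2 fun b _ => h1b b
  rw [periodicInteraction_split_two w L Z,
    ENNReal.toReal_add (ENNReal.add_ne_top.2 ⟨h01, hs0⟩) (ENNReal.add_ne_top.2 ⟨hs1, htt⟩),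
    ENNReal.toReal_add h01 hs0, ENNReal.toReal_add hs1 htt, ENNReal.toReal_sum (fun b _ => h0b b),
    ENNReal.toReal_sum (fun b _ => h1b b)]

/-- The exchange integral `O = R_{10} = ∫_{Λ^{m+2}} W.toReal · B`. -/
def exchInt (w : ℝ → ℝ≥0∞) (L : ℝ) (k : Fin 3 → ℤ) (Φ : Config (m + 1) → ℂ) : ℂ :=
  ∫ Z in cellN (m + 2) L, ((periodicInteraction w L Z).toReal : ℂ) * exchFactor L k Φ Z

/-- **Step (4)**: `O = E + ∑_b s_b + (∑_b conj(s_b) + P[aΦ].toReal/(m+1))` for a core `Φ` with `P[Φ] < ∞` and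
integrable `w`. -/
theorem exchInt_eq (hL : 0 < L) {w : ℝ → ℝ≥0∞} (hw : Measurable w) (hint : (∫⁻ z : Space, w ‖z‖) ≠ ⊤)
    (k : Fin 3 → ℤ) {Φ : Config (m + 1) → ℂ} (hΦ : IsCore L Φ) (hP : potForm w L Φ ≠ ⊤) :
    exchInt w L k Φ = exchCoef w L k Φ + ∑ b : Fin m, mixCoef w L k Φ b +
      (∑ b : Fin m, conj (mixCoef w L k Φ b) +
        (((potForm w L (modeAn L (planeWaveMode L k) Φ)).toReal / (m + 1) : ℝ) : ℂ)) := by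
  have hΦc := hΦ.contDiff.continuous
  have hF3 := integrable_piece hL hw hint k hΦc (measurable_periodizedPotential_pair hw L 0 1)
    (fun Z => periodizedPotential_le_periodicInteraction w L Z Fin.zero_lt_one)
  have hF4 : ∀ b : Fin m, Integrable (fun Z : Config (m + 2) =>
      ((periodizedPotential w L (Z 0 - Z b.succ.succ)).toReal : ℂ) * exchFactor L k Φ Z)
      ((volume : Measure (Config (m + 2))).restrict (cellN (m + 2) L)) := fun b =>
    integrable_piece hL hw hint k hΦc (measurable_periodizedPotential_pair hw L 0 b.succ.succ)
      (fun Z => periodizedPotential_le_periodicInteraction w L Z (Fin.succ_pos _))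
  have hF2 : ∀ b : Fin m, Integrable (fun Z : Config (m + 2) =>
      ((periodizedPotential w L (Z 1 - Z b.succ.succ)).toReal : ℂ) * exchFactor L k Φ Z)
      ((volume : Measure (Config (m + 2))).restrict (cellN (m + 2) L)) := fun b =>
    integrable_piece hL hw hint k hΦc (measurable_periodizedPotential_pair hw L 1 b.succ.succ)
      (fun Z => periodizedPotential_le_periodicInteraction w L Z (Fin.one_lt_succ_succ b))
  have hF1 := integrable_piece hL hw hint k hΦc (V := fun Z => periodicInteraction w L (Fin.tail (Fin.tail Z)))
    ((measurable_periodicInteraction_tk hw L).comp (measurable_tail.comp measurable_tail))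
    (fun Z : Config (m + 2) => (periodicInteraction_tail_le w L _).trans (periodicInteraction_tail_le w L Z))
  have hae : ∀ᵐ Z ∂((volume : Measure (Config (m + 2))).restrict (cellN (m + 2) L)),
      ((periodicInteraction w L Z).toReal : ℂ) * exchFactor L k Φ Z =
        ((periodizedPotential w L (Z 0 - Z 1)).toReal : ℂ) * exchFactor L k Φ Z +
          ∑ b : Fin m, ((periodizedPotential w L (Z 0 - Z b.succ.succ)).toReal : ℂ) * exchFactor L k Φ Z +
        (∑ b : Fin m, ((periodizedPotential w L (Z 1 - Z b.succ.succ)).toReal : ℂ) * exchFactor L k Φ Z +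
          ((periodicInteraction w L (Fin.tail (Fin.tail Z))).toReal : ℂ) * exchFactor L k Φ Z) := by
    filter_upwards [ae_lt_top (measurable_periodicInteraction_tk hw L)
      (lintegral_cellN_periodicInteraction_ne_top hL hw hint (m + 2))] with Z hZ
    rw [toReal_periodicInteraction_split_two w L hZ.ne]
    push_cast
    simp only [add_mul, Finset.sum_mul]
  rw [exchInt, integral_congr_ae hae,
    integral_add (hF3.fun_add (integrable_finsetSum _ fun b _ => hF4 b))
      ((integrable_finsetSum _ fun b _ => hF2 b).fun_add hF1),
    integral_add hF3 (integrable_finsetSum _ fun b _ => hF4 b),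
    integral_add (integrable_finsetSum _ fun b _ => hF2 b) hF1,
    integral_finsetSum _ (fun b _ => hF4 b), integral_finsetSum _ (fun b _ => hF2 b),
    piece_pair hL hw hint k hΦc, piece_tailTail hL hw hint k hΦc, integral_pot_norm_sliceCoef_sq hL hw hint k hΦ hP]
  simp only [piece_zeroSpect hL hw hint k hΦc, piece_oneSpect hL hw hint k hΦc]

/-- **Step (4), real part** (`re_O01_eq` of the brief, for `O = R_{10}`):
`Re O = P[aΦ].toReal/(m+1) + 2 ∑_b Re s_b + Re E`. -/
theorem re_exchInt_eq (hL : 0 < L) {w : ℝ → ℝ≥0∞} (hw : Measurable w) (hint : (∫⁻ z : Space, w ‖z‖) ≠ ⊤)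
    (k : Fin 3 → ℤ) {Φ : Config (m + 1) → ℂ} (hΦ : IsCore L Φ) (hP : potForm w L Φ ≠ ⊤) :
    (exchInt w L k Φ).re = (potForm w L (modeAn L (planeWaveMode L k) Φ)).toReal / (m + 1) +
      2 * ∑ b : Fin m, (mixCoef w L k Φ b).re + (exchCoef w L k Φ).re := by
  rw [exchInt_eq hL hw hint k hΦ hP]
  simp only [Complex.add_re, Complex.re_sum, Complex.conj_re, Complex.ofReal_re]
  ring

/-! ## Steps (3b) and (5): the direct term via P-dir, and the assembly of P-b -/

/-- P-b (the particle state): `P[a†Φ].toReal = P[Φ].toReal + (m+1)‖w‖₁/L³‖Φ‖² + P[aΦ].toReal + 2(m+1)∑_b Re s_b + (m+1) Re E`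
(same hypotheses). -/
theorem potForm_modeCr (hL : 0 < L) {w : ℝ → ℝ≥0∞} (hw : Measurable w) (hint : (∫⁻ z : Space, w ‖z‖) ≠ ⊤) (k : Fin 3 → ℤ)
    {Φ : Config (m + 1) → ℂ} (hΦ : IsCore L Φ) (hP : potForm w L Φ ≠ ⊤) :
    (potForm w L (modeCr (planeWaveMode L k) Φ)).toReal =
      (potForm w L Φ).toReal + (m + 1) * wL1 w / L ^ 3 * (normSq L Φ).toReal +
        (potForm w L (modeAn L (planeWaveMode L k) Φ)).toReal +
        2 * ((m + 1) * ∑ b : Fin m, (mixCoef w L k Φ b).re) + (m + 1) * (exchCoef w L k Φ).re := by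
  have hΦc := hΦ.contDiff.continuous
  have hred := toReal_potForm_modeCr_reduce hL hw hint k hΦ hP
  have hO : (∫ Z in cellN (m + 2) L, ((periodicInteraction w L Z).toReal : ℂ) *
      (conj (planeWaveMode L k (Z 1) * Φ (Fin.removeNth 1 Z)) * (planeWaveMode L k (Z 0) * Φ (Fin.removeNth 0 Z)))) =
      exchInt w L k Φ := rfl
  have hN : normSq L Φ ≠ ⊤ := (lintegral_cellN_sq_lt_top L hΦc).ne
  rw [hO, re_exchInt_eq hL hw hint k hΦ hP, lintegral_pot_sq_planeWaveMode_sq_tail hL hw k hΦc,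
    ENNReal.toReal_add hP (ENNReal.mul_ne_top (ENNReal.mul_ne_top ENNReal.ofReal_ne_top hint) hN),
    ENNReal.toReal_mul, ENNReal.toReal_mul, ENNReal.toReal_ofReal (div_nonneg (by positivity) (pow_nonneg hL.le 3))]
    at hred
  rw [hred, wL1]
  have hm : (m + 1 : ℝ) ≠ 0 := by positivity
  field_simp
  ring

end Summit.AtomisticToContinuum.BoseEinsteinCondensation.Cruxes.PeriodicIRBound.LinearPhFloorWagner.WF

end

noncomputable section

open scoped BigOperators ENNReal ComplexConjugate
open Filter MeasureTheory

namespace Summit.AtomisticToContinuum.BoseEinsteinCondensation.Cruxes.PeriodicIRBound.LinearPhFloorWagner.WF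

open Literature.MathematicalPhysics.QuantumManyBody.BoseGas

variable {M m n : ℕ} {L : ℝ}

/-- **P (the potential Wagner–Feynman inequality)**: for a core `(m+1)`-body `Φ` with `P[Φ] < ∞` and integrable `w`,
`P[aΦ] + P[a†Φ] ≤ P[Φ] + 2(m+1)‖w‖₁/L³ ‖Φ‖² + 2 potRe_w(Φ, n̂Φ)` (reals). -/
theorem pot_wagnerFeynman (hL : 0 < L) {w : ℝ → ℝ≥0∞} (hw : Measurable w) (hint : (∫⁻ z : Space, w ‖z‖) ≠ ⊤)
    (k : Fin 3 → ℤ) {Φ : Config (m + 1) → ℂ} (hΦ : IsCore L Φ) (hP : potForm w L Φ ≠ ⊤) :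
    (potForm w L (modeAn L (planeWaveMode L k) Φ)).toReal + (potForm w L (modeCr (planeWaveMode L k) Φ)).toReal ≤
      (potForm w L Φ).toReal + 2 * ((m + 1) * wL1 w / L ^ 3) * (normSq L Φ).toReal +
        2 * potRe w L Φ (modeCr (planeWaveMode L k) (modeAn L (planeWaveMode L k) Φ)) := by
  rw [potForm_modeCr hL hw hint k hΦ hP, potRe_numOp hL hw hint k hΦ hP]
  have hE := abs_exchCoef_re_le hL hw hint k hΦ.contDiff.continuous
  have hm : (0 : ℝ) ≤ m + 1 := by positivity
  have h2 : (m + 1 : ℝ) * (exchCoef w L k Φ).re ≤ (m + 1) * (wL1 w / L ^ 3 * (normSq L Φ).toReal) :=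
    mul_le_mul_of_nonneg_left (abs_le.1 hE).2 hm
  have h3 : (m + 1 : ℝ) * (exchCoef w L k Φ).re ≤ (m + 1) * wL1 w / L ^ 3 * (normSq L Φ).toReal :=
    h2.trans_eq (by ring)
  linarith [h3]

end Summit.AtomisticToContinuum.BoseEinsteinCondensation.Cruxes.PeriodicIRBound.LinearPhFloorWagner.WF

end

namespace Summit.AtomisticToContinuum.BoseEinsteinCondensation.Cruxes.PeriodicIRBound.LinearPhFloorWagner

/-- The registered sub-goal `stub_wfPotCreate3` of the crux ledger: this file's headline lemma `WF.potForm_modeCr`. -/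
theorem stub_wfPotCreate3 : WF.Pkg.PotCreate3 :=
  @WF.potForm_modeCr

end Summit.AtomisticToContinuum.BoseEinsteinCondensation.Cruxes.PeriodicIRBound.LinearPhFloorWagner
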